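import Mathlib
import HarnessLib
import Summits.KontsevichZagierPeriods.Zeta5Search.Denom.LineProfileShape

/-!
# The L(2/5) tale-1 line profile and its shape at `ξ = 127/10` (L(2/5) decay, one-variable side)

HONEST FRAMING: systematic search; no irrationality claim unless certified.  This file proves
elementary real-analysis facts about an explicit function of one variable; no statement about
`ζ(2)`, `ζ(5)` or any linear form is made here.  Cell pub-zeta5 (measure-opt g0); it is the L(2/5) twin of
P1's `TwoTaleD1LineProfileShape` (file T4 of the D1 programme `families/denom/D1-DESIGN-NOTE.md`).
L(2/5) is the first-tale cone point `(32,27,22,37 | 0,5,10,64)` of [Zudilin2014ZetaTwo, §3] (rung `s = 2/5` of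
fam-measure g8's ladder `L(s)`).  Seen from `u = t − (27n+1) = (ξ − 27) n + iηn`, the rational function `R(t)` has the
numerator blocks `(0, 32n]`, `(5n, 27n]`, `(10n, 22n]` and the denominator block `(37n, 64n+1]`, so — with
the generic primitive `gPrim` of `Denom/LineProfile.lean` — its scaled line profile is
`profileL25 ξ η = profileL250 ξ η − 2π|η|`, `profileL250 ξ η = (gPrim η (ξ+5) − gPrim η (ξ−27))
+ (gPrim η ξ − gPrim η (ξ−22)) + (gPrim η (ξ−5) − gPrim η (ξ−17)) − (gPrim η (ξ+37) − gPrim η (ξ+10))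
+ profileL25Const`, `profileL25Const = 27 log 27 − 32 log 32 − 22 log 22 − 12 log 12 + 39`.  On the design
line `ξ = 127/10` (saddle `ξ* = 12.70013`, `η* = 5.22958`, value `−71.44179775`; on the line `η* = 5.22960`,
`sup = −71.44179774`, loss `4·10⁻⁹` nats; `HOME/pub-zeta5-measure-opt/g0/design/`) put
`PL η = profileL25 (127/10) η` and `DL η = angleL25 (127/10) η − 2π` (`hasDerivAt_PL`).
* `DL_eq`: `DL = numLegsL − denAngleL − 2π`, six antitone legs `arctan (w/η)`,
  `w ∈ {177, 143, 127, 93, 77, 43}/10`, and `denAngleL η = arctan (497/(10η)) − arctan (227/(10η))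
  = arctan (27η/(η² + 112819/100))` (`denAngleL_eq`), monotone on `(0, 33]` since `33² < 112819/100`.
* `DL_antitoneOn` (`PL` concave on `(0, 33]`), `DL_neg_of_ge` and `DL_le_neg_four` (`DL ≤ −4`
  on `[33, ∞)`: `arctan x ≤ x`, `66/33 + 4 ≤ 2π`), `PL_tail` (`PL η ≤ PL 33 − 4 (η − 33)`, `η ≥ 33`).
* `twoPointL`: if `0 < η₁ ≤ η₂ ≤ 33`, `0 ≤ DL η₁`, `DL η₂ ≤ 0` then
  `PL η ≤ PL η₁ + DL η₁ (η₂ − η₁)` for all `η > 0`;  `PL_eq`: `PL` as eight signed values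
  `gPrim η (p/10)` plus `profileL25Const − 2π|η|`.
The numerical instance (`η₁ = 5.2293`, `η₂ = 5.2299`) is certified in `TwoTaleL25LineCertificate.lean`.
-/

noncomputable section

open Real Set

namespace Summit.KontsevichZagierPeriods.Zeta5Search.TwoTaleL25LineProfileShape

open Summit.KontsevichZagierPeriods.Zeta5Search.Denom.LineProfile
open Summit.KontsevichZagierPeriods.Zeta5Search.Denom.LineProfileShape (arctan_div_anti)

/-! ## The L(2/5) profile (generic abscissa `ξ`) -/

/-- The factorial constant `27 log 27 − 32 log 32 − 22 log 22 − 12 log 12 + 39` of the L(2/5)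
profile. -/
def profileL25Const : ℝ :=
  27 * Real.log 27 - 32 * Real.log 32 - 22 * Real.log 22 - 12 * Real.log 12 + 39

/-- `profileL250 ξ η`: the `2π|η|`-free part of the L(2/5) line profile at abscissa `ξ` —
numerator blocks `(ξ+5 | ξ−27)`, `(ξ | ξ−22)`, `(ξ−5 | ξ−17)`, denominator block `(ξ+37 | ξ+10)`,
and `profileL25Const`. -/
def profileL250 (ξ η : ℝ) : ℝ :=
  (gPrim η (ξ + 5) - gPrim η (ξ - 27)) + (gPrim η ξ - gPrim η (ξ - 22))
    + (gPrim η (ξ - 5) - gPrim η (ξ - 17)) - (gPrim η (ξ + 37) - gPrim η (ξ + 10)) + profileL25Const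

/-- The L(2/5) line profile `profileL25 ξ η = profileL250 ξ η − 2π|η|`. -/
def profileL25 (ξ η : ℝ) : ℝ := profileL250 ξ η - 2 * Real.pi * |η|

/-- `angleL25 ξ η`: the `η`-derivative of `profileL250 ξ` (a signed sum of eight angles). -/
def angleL25 (ξ η : ℝ) : ℝ :=
  (Real.arctan ((ξ + 5) / η) - Real.arctan ((ξ - 27) / η))
    + (Real.arctan (ξ / η) - Real.arctan ((ξ - 22) / η))
    + (Real.arctan ((ξ - 5) / η) - Real.arctan ((ξ - 17) / η))
    - (Real.arctan ((ξ + 37) / η) - Real.arctan ((ξ + 10) / η))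

/-- `profileL250` is even in `η`. -/
theorem profileL250_neg_eta (ξ η : ℝ) : profileL250 ξ (-η) = profileL250 ξ η := by
  simp only [profileL250, gPrim_neg_eta]

/-- `profileL25` is even in `η`. -/
theorem profileL25_neg_eta (ξ η : ℝ) : profileL25 ξ (-η) = profileL25 ξ η := by
  simp only [profileL25, profileL250_neg_eta, abs_neg]

/-- `d/dη profileL250 ξ η = angleL25 ξ η` for `η ≠ 0`. -/
theorem hasDerivAt_profileL250_eta (ξ : ℝ) {η : ℝ} (hη : η ≠ 0) :
    HasDerivAt (fun η : ℝ => profileL250 ξ η) (angleL25 ξ η) η := by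
  have h := fun w => hasDerivAt_gPrim_eta hη w
  have key := (((((h (ξ + 5)).sub (h (ξ - 27))).add ((h ξ).sub (h (ξ - 22)))).add
    ((h (ξ - 5)).sub (h (ξ - 17)))).sub ((h (ξ + 37)).sub (h (ξ + 10)))).add_const profileL25Const
  exact key

/-- `d/dη profileL25 ξ η = angleL25 ξ η − 2π` for `η > 0`. -/
theorem hasDerivAt_profileL25_eta (ξ : ℝ) {η : ℝ} (hη : 0 < η) :
    HasDerivAt (fun η : ℝ => profileL25 ξ η) (angleL25 ξ η - 2 * Real.pi) η := by
  have habs : HasDerivAt (fun η : ℝ => 2 * Real.pi * |η|) (2 * Real.pi * 1) η := by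
    refine ((hasDerivAt_id' η).congr_of_eventuallyEq ?_).const_mul (2 * Real.pi)
    filter_upwards [Ioi_mem_nhds hη] with x hx using abs_of_pos hx
  have key : HasDerivAt (fun η : ℝ => profileL250 ξ η - 2 * Real.pi * |η|)
      (angleL25 ξ η - 2 * Real.pi * 1) η := (hasDerivAt_profileL250_eta ξ hη.ne').sub habs
  rw [mul_one] at key
  exact key

/-- `profileL25 ξ` is continuous on `(0, ∞)`. -/
theorem continuousOn_profileL25 (ξ : ℝ) : ContinuousOn (fun η : ℝ => profileL25 ξ η) (Ioi 0) :=
  fun _ hη => (hasDerivAt_profileL25_eta ξ hη).continuousAt.continuousWithinAt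

/-! ## The line `ξ = 127/10` -/

/-- `PL η = profileL25 (127/10) η`, the L(2/5) line profile on the line `ξ = 127/10`. -/
def PL (η : ℝ) : ℝ := profileL25 (127 / 10) η

/-- `DL η = angleL25 (127/10) η − 2π` (the derivative of `PL` on `(0, ∞)`). -/
def DL (η : ℝ) : ℝ := angleL25 (127 / 10) η - 2 * Real.pi

/-- The six numerator legs `arctan (w/η)`, `w ∈ {177, 143, 127, 93, 77, 43}/10`. -/
def numLegsL (η : ℝ) : ℝ :=
  Real.arctan (177 / 10 / η) + Real.arctan (143 / 10 / η) + Real.arctan (127 / 10 / η)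
    + Real.arctan (93 / 10 / η) + Real.arctan (77 / 10 / η) + Real.arctan (43 / 10 / η)

/-- The denominator angle `arctan (497/(10η)) − arctan (227/(10η))`. -/
def denAngleL (η : ℝ) : ℝ := Real.arctan (497 / 10 / η) - Real.arctan (227 / 10 / η)

/-- `d/dη PL = DL` on `(0, ∞)`. -/
theorem hasDerivAt_PL {η : ℝ} (hη : 0 < η) : HasDerivAt PL (DL η) η :=
  hasDerivAt_profileL25_eta (127 / 10) hη

/-- `DL = numLegsL − denAngleL − 2π`. -/
theorem DL_eq (η : ℝ) : DL η = numLegsL η - denAngleL η - 2 * Real.pi := by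
  simp only [DL, angleL25, numLegsL, denAngleL]
  have e1 : ((127 : ℝ) / 10 + 5) / η = 177 / 10 / η := by ring
  have e2 : ((127 : ℝ) / 10 - 27) / η = -(143 / 10 / η) := by ring
  have e3 : ((127 : ℝ) / 10) / η = 127 / 10 / η := by ring
  have e4 : ((127 : ℝ) / 10 - 22) / η = -(93 / 10 / η) := by ring
  have e5 : ((127 : ℝ) / 10 - 5) / η = 77 / 10 / η := by ring
  have e6 : ((127 : ℝ) / 10 - 17) / η = -(43 / 10 / η) := by ring
  have e7 : ((127 : ℝ) / 10 + 37) / η = 497 / 10 / η := by ring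
  have e8 : ((127 : ℝ) / 10 + 10) / η = 227 / 10 / η := by ring
  rw [e1, e2, e3, e4, e5, e6, e7, e8, Real.arctan_neg, Real.arctan_neg, Real.arctan_neg]
  ring

/-- `PL = (eight signed values of gPrim at p/10) + profileL25Const − 2π|η|`. -/
theorem PL_eq (η : ℝ) : PL η =
    gPrim η (177 / 10) + gPrim η (143 / 10) + gPrim η (127 / 10) + gPrim η (93 / 10)
      + gPrim η (77 / 10) + gPrim η (43 / 10) - gPrim η (497 / 10) + gPrim η (227 / 10)
      + profileL25Const - 2 * Real.pi * |η| := by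
  simp only [PL, profileL25, profileL250]
  have e1 : gPrim η ((127 : ℝ) / 10 + 5) = gPrim η (177 / 10) := by norm_num
  have e2 : gPrim η ((127 : ℝ) / 10 - 27) = -gPrim η (143 / 10) := by
    rw [show ((127 : ℝ) / 10 - 27) = -(143 / 10) by norm_num, gPrim_neg]
  have e3 : gPrim η ((127 : ℝ) / 10) = gPrim η (127 / 10) := by norm_num
  have e4 : gPrim η ((127 : ℝ) / 10 - 22) = -gPrim η (93 / 10) := by
    rw [show ((127 : ℝ) / 10 - 22) = -(93 / 10) by norm_num, gPrim_neg]
  have e5 : gPrim η ((127 : ℝ) / 10 - 5) = gPrim η (77 / 10) := by norm_num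
  have e6 : gPrim η ((127 : ℝ) / 10 - 17) = -gPrim η (43 / 10) := by
    rw [show ((127 : ℝ) / 10 - 17) = -(43 / 10) by norm_num, gPrim_neg]
  have e7 : gPrim η ((127 : ℝ) / 10 + 37) = gPrim η (497 / 10) := by norm_num
  have e8 : gPrim η ((127 : ℝ) / 10 + 10) = gPrim η (227 / 10) := by norm_num
  rw [e1, e2, e3, e4, e5, e6, e7, e8]
  ring

/-- Closed form `denAngleL η = arctan (27η / (η² + 112819/100))` for `η > 0` (`Real.arctan_add`). -/
theorem denAngleL_eq {η : ℝ} (hη : 0 < η) :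
    denAngleL η = Real.arctan (27 * η / (η ^ 2 + 112819 / 100)) := by
  have hη' : η ≠ 0 := hη.ne'
  unfold denAngleL
  have hx : 0 < 497 / 10 / η := by positivity
  have hy : 0 < 227 / 10 / η := by positivity
  have h1 : (497 / 10 / η) * (-(227 / 10 / η)) < 1 := by nlinarith
  rw [sub_eq_add_neg, ← Real.arctan_neg, Real.arctan_add h1]
  congr 1
  have hD1 : (1 - 497 / 10 / η * -(227 / 10 / η)) ≠ 0 := by
    have : 0 < 1 - 497 / 10 / η * -(227 / 10 / η) := by nlinarith [mul_pos hx hy]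
    exact this.ne'
  have hD2 : η ^ 2 + 112819 / 100 ≠ 0 := by positivity
  rw [div_eq_div_iff hD1 hD2]
  field_simp
  ring

/-- `denAngleL` is monotone on `(0, 33]` (`33² = 1089 < 112819/100`). -/
theorem denAngleL_mono {s t : ℝ} (hs : 0 < s) (hst : s ≤ t) (ht : t ≤ 33) :
    denAngleL s ≤ denAngleL t := by
  rw [denAngleL_eq hs, denAngleL_eq (hs.trans_le hst)]
  apply Real.arctan_mono
  rw [div_le_div_iff₀ (by positivity) (by positivity)]
  have hst' : s * t ≤ 33 * 33 := mul_le_mul (hst.trans ht) ht (hs.le.trans hst) (by norm_num)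
  nlinarith [mul_nonneg (sub_nonneg.2 hst) (by linarith : (0 : ℝ) ≤ 112819 / 100 - s * t)]

/-- `DL` is antitone on `(0, 33]`. -/
theorem DL_antitoneOn {s t : ℝ} (hs : 0 < s) (hst : s ≤ t) (ht : t ≤ 33) : DL t ≤ DL s := by
  rw [DL_eq, DL_eq]
  have hd := denAngleL_mono hs hst ht
  have l1 := arctan_div_anti (177 / 10) (by norm_num) hs hst
  have l2 := arctan_div_anti (143 / 10) (by norm_num) hs hst
  have l3 := arctan_div_anti (127 / 10) (by norm_num) hs hst
  have l4 := arctan_div_anti (93 / 10) (by norm_num) hs hst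
  have l5 := arctan_div_anti (77 / 10) (by norm_num) hs hst
  have l6 := arctan_div_anti (43 / 10) (by norm_num) hs hst
  unfold numLegsL
  linarith

/-- `DL η < 0` for `η ≥ 33` (`arctan x ≤ x`, `66/33 < 2π`). -/
theorem DL_neg_of_ge {η : ℝ} (hη : 33 ≤ η) : DL η < 0 := by
  rw [DL_eq]
  have hη0 : 0 < η := by linarith
  have hden : 0 ≤ denAngleL η := by
    unfold denAngleL
    have : Real.arctan (227 / 10 / η) ≤ Real.arctan (497 / 10 / η) :=
      Real.arctan_mono (div_le_div_of_nonneg_right (by norm_num) hη0.le)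
    linarith
  have leg : ∀ c : ℝ, 0 ≤ c → Real.arctan (c / η) ≤ c / 33 := fun c hc =>
    (show Real.arctan (c / η) ≤ c / η from by
      have ht : (0:ℝ) ≤ c / η := div_nonneg hc hη0.le
      have h0 : 0 ≤ Real.arctan (c / η) := by simpa using Real.arctan_mono ht
      have h := Real.le_tan h0 (Real.arctan_lt_pi_div_two _)
      rwa [Real.tan_arctan] at h).trans
      (div_le_div_of_nonneg_left hc (by norm_num) hη)
  have l1 := leg (177 / 10) (by norm_num)
  have l2 := leg (143 / 10) (by norm_num)
  have l3 := leg (127 / 10) (by norm_num)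
  have l4 := leg (93 / 10) (by norm_num)
  have l5 := leg (77 / 10) (by norm_num)
  have l6 := leg (43 / 10) (by norm_num)
  unfold numLegsL
  nlinarith [Real.pi_gt_three]

/-- `DL η ≤ −4` for `η ≥ 33` (`arctan x ≤ x`, `66/33 + 4 ≤ 2π`). -/
theorem DL_le_neg_four {η : ℝ} (hη : 33 ≤ η) : DL η ≤ -4 := by
  rw [DL_eq]
  have hη0 : 0 < η := by linarith
  have hden : 0 ≤ denAngleL η := by
    unfold denAngleL
    have : Real.arctan (227 / 10 / η) ≤ Real.arctan (497 / 10 / η) :=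
      Real.arctan_mono (div_le_div_of_nonneg_right (by norm_num) hη0.le)
    linarith
  have leg : ∀ c : ℝ, 0 ≤ c → Real.arctan (c / η) ≤ c / 33 := fun c hc =>
    (show Real.arctan (c / η) ≤ c / η from by
      have ht : (0:ℝ) ≤ c / η := div_nonneg hc hη0.le
      have h0 : 0 ≤ Real.arctan (c / η) := by simpa using Real.arctan_mono ht
      have h := Real.le_tan h0 (Real.arctan_lt_pi_div_two _)
      rwa [Real.tan_arctan] at h).trans
      (div_le_div_of_nonneg_left hc (by norm_num) hη)
  have l1 := leg (177 / 10) (by norm_num)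
  have l2 := leg (143 / 10) (by norm_num)
  have l3 := leg (127 / 10) (by norm_num)
  have l4 := leg (93 / 10) (by norm_num)
  have l5 := leg (77 / 10) (by norm_num)
  have l6 := leg (43 / 10) (by norm_num)
  unfold numLegsL
  linarith [Real.pi_gt_three]

/-- Tail slope: `PL η ≤ PL 33 − 4 (η − 33)` for `η ≥ 33` (mean value theorem and `DL_le_neg_four`). -/
theorem PL_tail {η : ℝ} (hη : 33 ≤ η) : PL η ≤ PL 33 - 4 * (η - 33) := by
  rcases hη.eq_or_lt with h | hlt
  · rw [← h]
    simp
  have cont : ContinuousOn PL (Icc 33 η) :=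
    (continuousOn_profileL25 (127 / 10)).mono fun x hx => lt_of_lt_of_le (by norm_num) hx.1
  have deriv : ∀ x ∈ Ioo 33 η, HasDerivAt PL (DL x) x := fun x hx =>
    hasDerivAt_PL (lt_trans (by norm_num) hx.1)
  obtain ⟨ξ, hξ, hslope⟩ := exists_hasDerivAt_eq_slope PL DL hlt cont deriv
  have h4 : DL ξ ≤ -4 := DL_le_neg_four hξ.1.le
  rw [hslope, div_le_iff₀ (by linarith)] at h4
  linarith

/-- **Two-point tangent lemma.**  If `0 < η₁ ≤ η₂ ≤ 33`, `0 ≤ DL η₁` and `DL η₂ ≤ 0`, then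
`PL η ≤ PL η₁ + DL η₁ · (η₂ − η₁)` for every `η > 0`. -/
theorem twoPointL {η₁ η₂ : ℝ} (h1 : 0 < η₁) (h12 : η₁ ≤ η₂) (h2 : η₂ ≤ 33) (hD1 : 0 ≤ DL η₁)
    (hD2 : DL η₂ ≤ 0) {η : ℝ} (hη : 0 < η) : PL η ≤ PL η₁ + DL η₁ * (η₂ - η₁) := by
  have cont : ∀ a b : ℝ, 0 < a → ContinuousOn PL (Icc a b) := fun a b ha =>
    (continuousOn_profileL25 (127 / 10)).mono fun x hx => lt_of_lt_of_le ha hx.1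
  have diff : ∀ a b : ℝ, 0 < a → DifferentiableOn ℝ PL (interior (Icc a b)) :=
    fun a b ha x hx => by
      rw [interior_Icc] at hx
      exact (hasDerivAt_PL (ha.trans hx.1)).differentiableAt.differentiableWithinAt
  have der : ∀ x : ℝ, 0 < x → deriv PL x = DL x := fun x hx => (hasDerivAt_PL hx).deriv
  have h2pos : 0 < η₂ := h1.trans_le h12
  -- the tangent bound on `[η₁, y]` for `y ≤ η₂`
  have mid : ∀ y : ℝ, η₁ ≤ y → y ≤ η₂ → PL y - PL η₁ ≤ DL η₁ * (y - η₁) :=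
    fun y hy1 hy2 =>
    (convex_Icc η₁ y).image_sub_le_mul_sub_of_deriv_le (cont η₁ y h1) (diff η₁ y h1)
      (C := DL η₁)
      (fun x hx => by
        rw [interior_Icc] at hx
        rw [der x (h1.trans hx.1)]
        exact DL_antitoneOn h1 hx.1.le (by linarith [hx.2]))
      η₁ ⟨le_rfl, hy1⟩ y ⟨hy1, le_rfl⟩ hy1
  rcases le_total η η₁ with hle | hge
  · have mono : MonotoneOn PL (Icc η η₁) :=
      monotoneOn_of_deriv_nonneg (convex_Icc η η₁) (cont η η₁ hη) (diff η η₁ hη) fun x hx => by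
        rw [interior_Icc] at hx
        rw [der x (hη.trans hx.1)]
        exact hD1.trans (DL_antitoneOn (hη.trans hx.1) hx.2.le (h12.trans h2))
    have := mono ⟨le_rfl, hle⟩ ⟨hle, le_rfl⟩ hle
    nlinarith [mul_nonneg hD1 (sub_nonneg.2 h12)]
  · rcases le_total η η₂ with hle2 | hge2
    · have := mid η hge hle2
      nlinarith [mul_le_mul_of_nonneg_left (by linarith : η - η₁ ≤ η₂ - η₁) hD1]
    · have anti : AntitoneOn PL (Icc η₂ η) :=
        antitoneOn_of_deriv_nonpos (convex_Icc η₂ η) (cont η₂ η h2pos) (diff η₂ η h2pos)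
          fun x hx => by
            rw [interior_Icc] at hx
            rw [der x (h2pos.trans hx.1)]
            rcases le_or_gt x 33 with hx13 | hx13
            · exact (DL_antitoneOn h2pos hx.1.le hx13).trans hD2
            · exact (DL_neg_of_ge hx13.le).le
      have hA := anti ⟨le_rfl, hge2⟩ ⟨hge2, le_rfl⟩ hge2
      have := mid η₂ h12 le_rfl
      linarith

end Summit.KontsevichZagierPeriods.Zeta5Search.TwoTaleL25LineProfileShape

end
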